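import Literature.MathematicalPhysics.QuantumFieldTheory.Balaban1983to89.B1Eq324BenfattoKernelSect5StepBound
import Literature.MathematicalPhysics.QuantumFieldTheory.Balaban1983to89.B1Eq324BenfattoKernelSect5PerBoxAtPavementUpper
import HarnessLib

/-!
# `Balaban1983to89.B1Eq324BenfattoKernelSect5StepBoundUpper` — [BenfattoEtAl1978] §5 pp. 155–159, (5.36) p. 159: ONE UPPER PAVEMENT STEP OF THE
# CLASS ROAD, CUMULANT SIDE CLOSED — the per-step hypotheses `hbox` (upper, under the extra conditioning) / `hE` (upper identification) of the class
# UPPER pavement chain produced as ONE existential statement per class member in standard position, from the cluster rows and the depth rows only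
# (the mirror of `…KernelSect5StepBound.exists_lower_step`)

statement-level skeleton of published theorems with citation tags; proofs where landed; nothing here is a claim about the
Yang–Mills mass gap

WHY THIS MODULE (cell `pub-ymgap`, seat `dag-n08-c` gen 31; node N08 [Balaban1985UV3]; the [BenfattoEtAl1978] source chain behind the (α)-row `h324`;
the (4.6) side of the ASSEMBLY layer over seat n08-d's class upper chain `…KernelSect5PavementChainUpper.upperPavementChainCond(_le_exp)` (p619737)).
That chain consumes, per step at the frame-`k` class member, (hbox) per-box UPPER bounds `∫_{χ^□_b}e^{Ψ_□}dN ≤ e^{u_k(□)}∫_{χ^□_b}e^{Ψ′₁+Ψ₂}dN` under the part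
field centred at the conditional mean GIVEN `C_k ∪ Γ₁` (the far conditioning set of (4.6) travels with the chain), and — for the collection of errors
(`…KernelSect5CollectErrors.le_exp_cumulantSum_add_of_chain`, v1.1) — (hE) `Σ_□u(□) ≤ cumulantSum μ_K H_J t − cumulantSum μ_K H_{Γ̄₁} t + idErr`.  This file
is the class edition of my concrete `…Sect5StepBound.exists_upper_step` (p577481): `hbox` from `…KernelSect5PerBoxAtPavementUpper.hboxU_of_clusterRows`
(row 10U; rows displayed, masses discharged by `…Sect5PerBoxAtPavement.mass_classes_le` / `weightedMass_classes_le`, (5.19)'s side condition by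
`card_shrink_mul_exp_le`), `hE` from `…KernelSect5Identification.identification_upper` with the four `|·|` bounded by `…KernelSect5StepBound.cumulantSide_le`
(the SAME closed cumulant-side bound as the lower step: the reference cumulants live under `𝒩(0,K)` on both sides).

WHAT IS PROVED (theorems only; no definition, no named fact, no `sorry`; axioms standard).
* ★★★ `exists_upper_step` (∃ `u Err`: hbox (upper, set-integral currency, conditioning `C ∪ Γ₁`) ∧ hE (upper) ∧ `Err = closed`, at one class member
  `(Λ, A, K)` in standard position with standard part kernels `Kb`, an extra conditioning set `C ⊆ Λ` missing the parts, and the depth rows (a)–(f)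
  DISPLAYED — the centre rows in the union form over data `γb`-small on `Γ₁` and `b`-small on `C`).

HONEST SCOPE / NOT HERE.  The union-centre rows' class suppliers (for a far `C`), the frame transport (`C_k`, `z̄_k`), the sum over the `d+1` steps
(n08-d's S8b) and the ledger are the sequel; one self-located piece of an UNCOMMISSIONED port (plan g81 (II), START-LIST v11 §n08) — nothing chained; no
generalised Basic Lemma is stated; nothing of [Balaban1985UV3] is asserted; count-neutral for N08; nothing about d = 4, the continuum, OS axioms, a mass
gap or the Clay problem.
-/

noncomputable section

open MeasureTheory ProbabilityTheory Finset Matrix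
open scoped BigOperators Nat NNReal

namespace Literature.MathematicalPhysics.QuantumFieldTheory.Balaban1983to89.B1Eq324BenfattoKernelSect5StepBoundUpper

open _root_.MeasureTheory _root_.ProbabilityTheory
open Literature.Probability.LatticeModels (setPartitions ursellOf cumulantOf)
open Literature.MathematicalPhysics.QuantumFieldTheory
open Literature.MathematicalPhysics.QuantumFieldTheory.Balaban1983to89.B1Eq324BenfattoLemma
open Literature.MathematicalPhysics.QuantumFieldTheory.Balaban1983to89.B1Eq324BenfattoSect5Boxes
open Literature.MathematicalPhysics.QuantumFieldTheory.Balaban1983to89.B1Eq324BenfattoSect5Eq511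
open Literature.MathematicalPhysics.QuantumFieldTheory.Balaban1983to89.B1Eq324BenfattoSect5Eq524
open Literature.MathematicalPhysics.QuantumFieldTheory.Balaban1983to89.B1Eq324BenfattoSect5Eq534
open Literature.MathematicalPhysics.QuantumFieldTheory.Balaban1983to89.B1Eq324BenfattoSect5Eq515
open Literature.MathematicalPhysics.QuantumFieldTheory.Balaban1983to89.B1Eq324BenfattoSect5Iteration (restrictCoef)
open Literature.MathematicalPhysics.QuantumFieldTheory.Balaban1983to89.B1Eq324BenfattoKernelOfPrecision (isPosSemidefKernel_kernel)
open Literature.MathematicalPhysics.QuantumFieldTheory.Balaban1983to89.B1Eq324BenfattoClassAppendixC (posDef_of_coercive)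
open Literature.MathematicalPhysics.QuantumFieldTheory.Balaban1983to89.B1Eq324BenfattoSect5PerBoxAtPavement
  (mass_classes_le weightedMass_classes_le card_shrink_mul_exp_le)
open Literature.MathematicalPhysics.QuantumFieldTheory.Balaban1983to89.B1Eq324BenfattoKernelSect5StepBound (cumulantSide_le)
open Literature.MathematicalPhysics.QuantumFieldTheory.Balaban1983to89.B1Eq324BenfattoKernelSect5PerBoxAtPavementUpper (hboxU_of_clusterRows)
open Literature.MathematicalPhysics.QuantumFieldTheory.Balaban1983to89.B1Eq324GaussianMomentLeaf (momentConst)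

variable {d : ℕ}
/-! ## One upper step of the class road, packaged for the upper chain -/

section Step

variable {Λ : Finset (B1Eq324BenfattoLemma.Site d)} {A : Matrix Λ Λ ℝ}
  {K : B1Eq324BenfattoLemma.Site d → B1Eq324BenfattoLemma.Site d → ℝ}
  (hK : ∀ x y, K x y = if h : x ∈ Λ ∧ y ∈ Λ then (A⁻¹ : Matrix Λ Λ ℝ) ⟨x, h.1⟩ ⟨y, h.2⟩ else 0)
  {s D : ℕ} {κ : ℝ} {a : Coef d} {J I : Finset (B1Eq324BenfattoLemma.Site d)} {L w v : ℕ}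
  {γ b Ac : ℝ}
  (hAs : ∀ e e', A e e' = A e' e) {γA : ℝ} (hγA0 : 0 < γA)
  (hγA : ∀ x : Λ → ℝ, γA * ∑ e, x e ^ 2 ≤ ∑ e, ∑ e', A e e' * x e * x e')
  (hΓΛ : corridors L w (J.image (boxIndex L)) ⊆ Λ) (hBΛ : ∀ m ∈ (J.image (boxIndex L)), box L m ⊆ Λ)
  {Kb : B1Eq324BenfattoLemma.Site d → B1Eq324BenfattoLemma.Site d → B1Eq324BenfattoLemma.Site d → ℝ}
  (hKb : ∀ m (hm : m ∈ (J.image (boxIndex L))) x y, Kb m x y = if h : x ∈ shrink L m w ∧ y ∈ shrink L m w then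
    ((A.submatrix (fun j : ↥(shrink L m w) => (⟨j, hBΛ m hm (shrink_subset_box L m w j.2)⟩ : Λ))
      (fun j : ↥(shrink L m w) => (⟨j, hBΛ m hm (shrink_subset_box L m w j.2)⟩ : Λ)))⁻¹ :
        Matrix ↥(shrink L m w) ↥(shrink L m w) ℝ) ⟨x, h.1⟩ ⟨y, h.2⟩ else 0)

include hK hAs hγA0 hγA hΓΛ hKb

/-- ★★★ **ONE UPPER STEP OF THE CLASS ROAD, PACKAGED FOR THE UPPER CHAIN** — at a class member `(Λ, A, K)` carrying a standard-position datum
`(J ⊆ I, a, b)` with the boxes `B = J.image boxIndex`, part kernels `Kb` (standard parts `□′∪Γ₂(□)`), an extra conditioning set `C ⊆ Λ` missing every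
`□′∪Γ₂(□)`, and the DISPLAYED depth rows — (a) `|Kb m|, |K| ≤ K₀`, (b) `ℓ¹` decay of `Kb m` and of `K` at rate `δ₀`, (e) `|Kb m − K| ≤ ε₃₁` at depth,
(f) `Kb m(x,x) ≤ ½`, and the CENTRE rows for `u_{C∪Γ₁}(ξ) = condMean K (C ∪ Γ₁) ξ` over data `ξ` `γb`-small on `Γ₁` and `b`-small on `C`: (c) `≤ Kᵤ` on
`I`, (d) `≤ ε₃₁` at depth, (f) `≤ ½b(1+d(Δ_x,I))` on `□′∪Γ₂(□)` —: there are per-box exponents `u(□)` and errors `Err(□)` (CLOSED, third conjunct) with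
(hbox) `∫_{χ^□_b}e^{Ψ_□}dN ≤ e^{u(□)}·∫_{χ^□_b}e^{Ψ′₁+Ψ₂}dN`, `N = 𝒩(u_{C∪Γ₁}(ξ), Kb □)`, for every `□ ∈ B` and every such `ξ`
(`…KernelSect5PerBoxAtPavementUpper.hboxU_of_clusterRows`) and (hE) `Σ_□u(□) ≤ cumulantSum μ_K H_J t − cumulantSum μ_K H_{Γ̄₁} t + (Σ_□Err(□) + [closed
cumulant-side bound of `cumulantSide_le`])` (`…KernelSect5Identification.identification_upper`) — exactly the per-step inputs of
`…KernelSect5PavementChainUpper.upperPavementChainCond` / `…KernelSect5CollectErrors.le_exp_cumulantSum_add_of_chain` (there at the frame-`k` datum).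
The class twin of `…Sect5StepBound.exists_upper_step`. [cite: BenfattoEtAl1978, (5.16)–(5.36) pp.155–159, (4.6) p.152] -/
theorem exists_upper_step (hκ : 0 < κ) (hJ : CoefSupportedIn a J) (hJI : J ⊆ I) (hAc0 : 0 ≤ Ac)
    (hA : ∀ (p : ℕ) (Δ : Fin p → B1Eq324BenfattoLemma.Site d) (n : Fin p → ℕ), |a p Δ n| ≤ Ac)
    (hL2 : 2 * (2 * w + v) < L) (hv : v ≤ w) (hb : 1 ≤ b) (hγ1 : γ ≤ 1)
    (hsmall : ((L : ℝ) ^ d) * Real.exp (-(b ^ 2 / 4)) ≤ 1 / 6)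
    {C : Finset (B1Eq324BenfattoLemma.Site d)} (hCΛ : C ⊆ Λ) (hCsh : ∀ m ∈ (J.image (boxIndex L)), Disjoint (shrink L m w) C)
    {Ku K₀ δ₀ ε₃₁ : ℝ} (hKu : 0 ≤ Ku) (hKuK : Ku ≤ K₀) (hK₀1 : 1 ≤ K₀) (hε₃₁ : 0 ≤ ε₃₁)
    (huI : ∀ ξ ∈ smallFieldOn (corridors L w (J.image (boxIndex L)) : Set (B1Eq324BenfattoLemma.Site d)) I (γ * b),
      ξ ∈ smallFieldOn ((C : Finset (B1Eq324BenfattoLemma.Site d)) : Set (B1Eq324BenfattoLemma.Site d)) I b →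
      ∀ y ∈ I, |condMean K (C ∪ corridors L w (J.image (boxIndex L))) ξ y| ≤ Ku)
    (hKR : ∀ m ∈ (J.image (boxIndex L)), ∀ x y, |Kb m x y| ≤ K₀) (hKrR : ∀ x y, |K x y| ≤ K₀)
    (hKdec : ∀ x y : B1Eq324BenfattoLemma.Site d, |K x y| ≤ K₀ * Real.exp (-(δ₀ * ∑ jj, |((x jj : ℝ) - (y jj : ℝ))|)))
    (hdec : ∀ m ∈ (J.image (boxIndex L)), ∀ x y : B1Eq324BenfattoLemma.Site d,
      |Kb m x y| ≤ K₀ * Real.exp (-(δ₀ * ∑ jj, |((x jj : ℝ) - (y jj : ℝ))|)))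
    (huε : ∀ m ∈ (J.image (boxIndex L)), ∀ ξ ∈ smallFieldOn (corridors L w (J.image (boxIndex L)) : Set (B1Eq324BenfattoLemma.Site d)) I (γ * b),
      ξ ∈ smallFieldOn ((C : Finset (B1Eq324BenfattoLemma.Site d)) : Set (B1Eq324BenfattoLemma.Site d)) I b →
      ∀ x ∈ shrink L m (w + (w - v)), |condMean K (C ∪ corridors L w (J.image (boxIndex L))) ξ x| ≤ ε₃₁)
    (hKε : ∀ m ∈ (J.image (boxIndex L)), ∀ x ∈ shrink L m (w + (w - v)), ∀ y, |Kb m x y - K x y| ≤ ε₃₁)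
    (hvar : ∀ m ∈ (J.image (boxIndex L)), ∀ x ∈ shrink L m w, Kb m x x ≤ 1 / 2)
    (hm : ∀ m ∈ (J.image (boxIndex L)), ∀ ξ ∈ smallFieldOn (corridors L w (J.image (boxIndex L)) : Set (B1Eq324BenfattoLemma.Site d)) I (γ * b),
      ξ ∈ smallFieldOn ((C : Finset (B1Eq324BenfattoLemma.Site d)) : Set (B1Eq324BenfattoLemma.Site d)) I b →
      ∀ x ∈ shrink L m w, |condMean K (C ∪ corridors L w (J.image (boxIndex L))) ξ x| ≤ 1 / 2 * b * (1 + distToRegion I x))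
    {δ : ℝ} (hδ : 0 < δ) (hδle : δ ≤ δ₀) (hres : 0 < κ / 2 - δ / 2 * ((D : ℝ) ^ 2 * Real.sqrt d)) (t : ℕ) :
    ∃ u Err : B1Eq324BenfattoLemma.Site d → ℝ,
      (∀ m ∈ (J.image (boxIndex L)), ∀ ξ : B1Eq324BenfattoLemma.Site d → ℝ,
        ξ ∈ smallFieldOn (corridors L w (J.image (boxIndex L)) : Set (B1Eq324BenfattoLemma.Site d)) I (γ * b) →
        ξ ∈ smallFieldOn ((C : Finset (B1Eq324BenfattoLemma.Site d)) : Set (B1Eq324BenfattoLemma.Site d)) I b →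
        ∫ z in smallFieldOn (shrink L m w : Set (B1Eq324BenfattoLemma.Site d)) I b,
            Real.exp (psiBox s D κ a L w m z) ∂((gaussianFieldOfKernel (Kb m)).map
              fun (ζ : B1Eq324BenfattoLemma.Site d → ℝ) (x : B1Eq324BenfattoLemma.Site d) => condMean K (C ∪ corridors L w (J.image (boxIndex L))) ξ x + ζ x)
          ≤ Real.exp (u m) * ∫ z in smallFieldOn (shrink L m w : Set (B1Eq324BenfattoLemma.Site d)) I b,
            Real.exp (psi1p s D κ a L w v m z + psi2 s D κ a L w m z) ∂((gaussianFieldOfKernel (Kb m)).map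
              fun (ζ : B1Eq324BenfattoLemma.Site d → ℝ) (x : B1Eq324BenfattoLemma.Site d) => condMean K (C ∪ corridors L w (J.image (boxIndex L))) ξ x + ζ x)) ∧
      (∑ m ∈ (J.image (boxIndex L)), u m ≤
        (cumulantSum (gaussianFieldOfKernel K) (hamiltonian s D κ a J) t - cumulantSum (gaussianFieldOfKernel K) (hamiltonian s D κ a (corridorsBar L w v (J.image (boxIndex L)))) t)
          + (∑ m ∈ (J.image (boxIndex L)), Err m +
            ∑ k ∈ Finset.range t,
          ((2 ^ (k + 1) * (2 ^ ((k + 1) * D) * 2 ^ 2 ^ ((k + 1) * D) * K₀ ^ ((k + 1) * D)) *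
          ((Ac * Real.exp (δ / 2 * ((D : ℝ) ^ 2 * d)) *
              Real.exp (-((κ / 2 - δ / 2 * ((D : ℝ) ^ 2 * Real.sqrt d)) / 2 * w))) * J.card *
            ∑ p ∈ Finset.Icc 1 s, ((admissible p D).card : ℝ) *
              ((2 / (1 - Real.exp (-((κ / 2 - δ / 2 * ((D : ℝ) ^ 2 * Real.sqrt d)) / 2 / (p : ℕ) / Real.sqrt d))) *
                Real.exp ((κ / 2 - δ / 2 * ((D : ℝ) ^ 2 * Real.sqrt d)) / 2 / (p : ℕ) / Real.sqrt d)) ^ d) ^ (p - 1)) *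
          (Ac * Real.exp (δ / 2 * ((D : ℝ) ^ 2 * d)) *
            ((1 : ℝ) * (2 / (1 - Real.exp (-(δ / (2 * ((k + 1 : ℕ) : ℝ)) / Real.sqrt d))) * Real.exp (δ / (2 * ((k + 1 : ℕ) : ℝ)) / Real.sqrt d)) ^ d) *
            ∑ p ∈ Finset.Icc 1 s, ((admissible p D).card : ℝ) *
              ((2 / (1 - Real.exp (-((κ / 2 - δ / 2 * ((D : ℝ) ^ 2 * Real.sqrt d)) / (p : ℕ) / Real.sqrt d))) *
                Real.exp ((κ / 2 - δ / 2 * ((D : ℝ) ^ 2 * Real.sqrt d)) / (p : ℕ) / Real.sqrt d)) ^ d) ^ (p - 1)) ^ k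
          + 2 ^ (k + 1) * (2 ^ ((k + 1) * D) * 2 ^ 2 ^ ((k + 1) * D) * K₀ ^ ((k + 1) * D)) *
        ((J.image (boxIndex L)).card * (Ac * Real.exp (δ / 2 * ((D : ℝ) ^ 2 * d)) * Real.exp (-((κ / 2 - δ / 2 * ((D : ℝ) ^ 2 * Real.sqrt d)) / 2 * v)) *
          (L : ℝ) ^ d * ∑ p ∈ Finset.Icc 1 s, ((admissible p D).card : ℝ) *
              ((2 / (1 - Real.exp (-((κ / 2 - δ / 2 * ((D : ℝ) ^ 2 * Real.sqrt d)) / 2 / (p : ℕ) / Real.sqrt d))) *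
                Real.exp ((κ / 2 - δ / 2 * ((D : ℝ) ^ 2 * Real.sqrt d)) / 2 / (p : ℕ) / Real.sqrt d)) ^ d) ^ (p - 1))) *
        (Ac * Real.exp (δ / 2 * ((D : ℝ) ^ 2 * d)) *
          (2 / (1 - Real.exp (-(δ / (2 * ((k + 1 : ℕ) : ℝ)) / Real.sqrt d))) * Real.exp (δ / (2 * ((k + 1 : ℕ) : ℝ)) / Real.sqrt d)) ^ d *
          ∑ p ∈ Finset.Icc 1 s, ((admissible p D).card : ℝ) *
              ((2 / (1 - Real.exp (-((κ / 2 - δ / 2 * ((D : ℝ) ^ 2 * Real.sqrt d)) / (p : ℕ) / Real.sqrt d))) *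
                Real.exp ((κ / 2 - δ / 2 * ((D : ℝ) ^ 2 * Real.sqrt d)) / (p : ℕ) / Real.sqrt d)) ^ d) ^ (p - 1)) ^ k)
          + (2 ^ (k + 1) * (2 ^ ((k + 1) * D) * 2 ^ 2 ^ ((k + 1) * D) * K₀ ^ ((k + 1) * D)) *
          (Ac * Real.exp (δ / 2 * ((D : ℝ) ^ 2 * d)) * Real.exp (-((κ / 2 - δ / 2 * ((D : ℝ) ^ 2 * Real.sqrt d)) / 2 * w)) *
            (corridorsBar L w v (J.image (boxIndex L))).card * ∑ p ∈ Finset.Icc 1 s, ((admissible p D).card : ℝ) *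
              ((2 / (1 - Real.exp (-((κ / 2 - δ / 2 * ((D : ℝ) ^ 2 * Real.sqrt d)) / 2 / (p : ℕ) / Real.sqrt d))) *
                Real.exp ((κ / 2 - δ / 2 * ((D : ℝ) ^ 2 * Real.sqrt d)) / 2 / (p : ℕ) / Real.sqrt d)) ^ d) ^ (p - 1)) *
          (Ac * Real.exp (δ / 2 * ((D : ℝ) ^ 2 * d)) *
            (2 / (1 - Real.exp (-(δ / (2 * ((k + 1 : ℕ) : ℝ)) / Real.sqrt d))) * Real.exp (δ / (2 * ((k + 1 : ℕ) : ℝ)) / Real.sqrt d)) ^ d *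
            ∑ p ∈ Finset.Icc 1 s, ((admissible p D).card : ℝ) *
              ((2 / (1 - Real.exp (-((κ / 2 - δ / 2 * ((D : ℝ) ^ 2 * Real.sqrt d)) / (p : ℕ) / Real.sqrt d))) *
                Real.exp ((κ / 2 - δ / 2 * ((D : ℝ) ^ 2 * Real.sqrt d)) / (p : ℕ) / Real.sqrt d)) ^ d) ^ (p - 1)) ^ k
          + 2 ^ (k + 1) * (2 ^ ((k + 1) * D) * 2 ^ 2 ^ ((k + 1) * D) * K₀ ^ ((k + 1) * D)) *
        ((J.image (boxIndex L)).card * (Ac * Real.exp (δ / 2 * ((D : ℝ) ^ 2 * d)) * Real.exp (-((κ / 2 - δ / 2 * ((D : ℝ) ^ 2 * Real.sqrt d)) / 2 * v)) *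
          (L : ℝ) ^ d * ∑ p ∈ Finset.Icc 1 s, ((admissible p D).card : ℝ) *
              ((2 / (1 - Real.exp (-((κ / 2 - δ / 2 * ((D : ℝ) ^ 2 * Real.sqrt d)) / 2 / (p : ℕ) / Real.sqrt d))) *
                Real.exp ((κ / 2 - δ / 2 * ((D : ℝ) ^ 2 * Real.sqrt d)) / 2 / (p : ℕ) / Real.sqrt d)) ^ d) ^ (p - 1))) *
        (Ac * Real.exp (δ / 2 * ((D : ℝ) ^ 2 * d)) *
          (2 / (1 - Real.exp (-(δ / (2 * ((k + 1 : ℕ) : ℝ)) / Real.sqrt d))) * Real.exp (δ / (2 * ((k + 1 : ℕ) : ℝ)) / Real.sqrt d)) ^ d *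
          ∑ p ∈ Finset.Icc 1 s, ((admissible p D).card : ℝ) *
              ((2 / (1 - Real.exp (-((κ / 2 - δ / 2 * ((D : ℝ) ^ 2 * Real.sqrt d)) / (p : ℕ) / Real.sqrt d))) *
                Real.exp ((κ / 2 - δ / 2 * ((D : ℝ) ^ 2 * Real.sqrt d)) / (p : ℕ) / Real.sqrt d)) ^ d) ^ (p - 1)) ^ k)
          + 2 ^ ((k + 1) * D) * 2 ^ 2 ^ ((k + 1) * D) * K₀ ^ ((k + 1) * D) *
        ((J.image (boxIndex L)).card * (((k + 1 : ℕ) : ℝ) * (k : ℝ) *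
          ((Ac * Real.exp (δ / 2 * ((D : ℝ) ^ 2 * d)) * ((L : ℝ) ^ d * (2 / (1 - Real.exp (-(δ / (2 * ((k + 1 : ℕ) : ℝ)) / Real.sqrt d))) * Real.exp (δ / (2 * ((k + 1 : ℕ) : ℝ)) / Real.sqrt d)) ^ d) *
              ∑ p ∈ Finset.Icc 1 s, ((admissible p D).card : ℝ) *
              ((2 / (1 - Real.exp (-((κ / 2 - δ / 2 * ((D : ℝ) ^ 2 * Real.sqrt d)) / (p : ℕ) / Real.sqrt d))) *
                Real.exp ((κ / 2 - δ / 2 * ((D : ℝ) ^ 2 * Real.sqrt d)) / (p : ℕ) / Real.sqrt d)) ^ d) ^ (p - 1)) * ((Ac * Real.exp (δ / 2 * ((D : ℝ) ^ 2 * d)) * Real.exp (-(δ / (2 * ((k + 1 : ℕ) : ℝ)) / 2 * ((w : ℝ) + v + 1))) * ((L : ℝ) ^ d * (2 / (1 - Real.exp (-(δ / (2 * ((k + 1 : ℕ) : ℝ)) / 2 / Real.sqrt d))) * Real.exp (δ / (2 * ((k + 1 : ℕ) : ℝ)) / 2 / Real.sqrt d)) ^ d) *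
              ∑ p ∈ Finset.Icc 1 s, ((admissible p D).card : ℝ) *
              ((2 / (1 - Real.exp (-((κ / 2 - δ / 2 * ((D : ℝ) ^ 2 * Real.sqrt d)) / (p : ℕ) / Real.sqrt d))) *
                Real.exp ((κ / 2 - δ / 2 * ((D : ℝ) ^ 2 * Real.sqrt d)) / (p : ℕ) / Real.sqrt d)) ^ d) ^ (p - 1)) *
             (Ac * Real.exp (δ / 2 * ((D : ℝ) ^ 2 * d)) * ((L : ℝ) ^ d * (2 / (1 - Real.exp (-(δ / (2 * ((k + 1 : ℕ) : ℝ)) / Real.sqrt d))) * Real.exp (δ / (2 * ((k + 1 : ℕ) : ℝ)) / Real.sqrt d)) ^ d) *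
              ∑ p ∈ Finset.Icc 1 s, ((admissible p D).card : ℝ) *
              ((2 / (1 - Real.exp (-((κ / 2 - δ / 2 * ((D : ℝ) ^ 2 * Real.sqrt d)) / (p : ℕ) / Real.sqrt d))) *
                Real.exp ((κ / 2 - δ / 2 * ((D : ℝ) ^ 2 * Real.sqrt d)) / (p : ℕ) / Real.sqrt d)) ^ d) ^ (p - 1)) ^ (k - 1)))))
          + (J.image (boxIndex L)).card * ((3 : ℝ) ^ (k + 1) *
        (2 ^ ((k + 1) * D) * 2 ^ 2 ^ ((k + 1) * D) * K₀ ^ ((k + 1) * D) *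
            Real.exp (-(δ / 2 * ((v : ℝ) + 1))) *
          (Ac * Real.exp (δ / 2 * ((D : ℝ) ^ 2 * d)) * (L : ℝ) ^ d * ∑ p ∈ Finset.Icc 1 s, ((admissible p D).card : ℝ) *
              ((2 / (1 - Real.exp (-((κ / 2 - δ / 2 * ((D : ℝ) ^ 2 * Real.sqrt d)) / (p : ℕ) / Real.sqrt d))) *
                Real.exp ((κ / 2 - δ / 2 * ((D : ℝ) ^ 2 * Real.sqrt d)) / (p : ℕ) / Real.sqrt d)) ^ d) ^ (p - 1)) ^ (k + 1)))) / (k + 1)!)) ∧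
      (∀ m, Err m =
          (2 * (2 ^ ((t + 1).choose 2) * (4 * (s1Const s D d κ * Ac * b ^ D * (L : ℝ) ^ d)) ^ (t + 1) / (t + 1)!) +
                Real.exp (2 * (4 * (s1Const s D d κ * Ac * b ^ D * (L : ℝ) ^ d))) *
                  (3 * (((shrink L m w).card : ℝ) * Real.exp (-(b ^ 2 / 4)))) +
                ∑ k ∈ Finset.range t,
                  (3 ^ (k + 1) * ((∑ π ∈ setPartitions (univ : Finset (Fin (k + 1))), ((π.card - 1)! : ℝ)) *
                      (s1Const s D d κ * Ac * b ^ D * Real.exp (-(κ / 4 * v)) * (L : ℝ) ^ d *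
                        (4 * (s1Const s D d κ * Ac * b ^ D * (L : ℝ) ^ d)) ^ k)) +
                    3 ^ (k + 1) * (2 ^ (k + 1) * ((∑ π ∈ setPartitions (univ : Finset (Fin (k + 1))), ((π.card - 1)! : ℝ)) *
                        ((min 1 (2 * ((shrink L m w).card : ℝ) * Real.exp (-(b ^ 2 / 4)))) ^ ((2 * (k + 1) : ℕ) : ℝ)⁻¹ *
                          ((1 + Ku) ^ D * (Ac * (L : ℝ) ^ d * ∑ p ∈ Finset.Icc 1 s, ((admissible p D).card : ℝ) *
          ((2 / (1 - Real.exp (-(κ / 2 / (p : ℕ) / Real.sqrt d))) * Real.exp (κ / 2 / (p : ℕ) / Real.sqrt d)) ^ d) ^ (p - 1)) * momentConst D (2 * (k + 1)) K₀.toNNReal) ^ (k + 1))) +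
                      2 ^ ((k + 1) * D) * 2 ^ 2 ^ ((k + 1) * D) * K₀ ^ ((k + 1) * D) * Real.exp (-(δ / 2 * ((v : ℝ) + 1))) *
                        (Ac * Real.exp (δ / 2 * ((D : ℝ) ^ 2 * d)) * (L : ℝ) ^ d * ∑ p ∈ Finset.Icc 1 s, ((admissible p D).card : ℝ) *
          ((2 / (1 - Real.exp (-((κ / 2 - δ / 2 * ((D : ℝ) ^ 2 * Real.sqrt d)) / (p : ℕ) / Real.sqrt d))) *
            Real.exp ((κ / 2 - δ / 2 * ((D : ℝ) ^ 2 * Real.sqrt d)) / (p : ℕ) / Real.sqrt d)) ^ d) ^ (p - 1)) ^ (k + 1)) +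
                    3 ^ (k + 1) * (2 ^ (k + 1) * ((∑ π ∈ setPartitions (univ : Finset (Fin (k + 1))), ((π.card - 1)! : ℝ)) *
                        ((min 1 (2 * ((shrink L m w).card : ℝ) * Real.exp (-(b ^ 2 / 4)))) ^ ((2 * (k + 1) : ℕ) : ℝ)⁻¹ *
                          ((1 + Ku) ^ D * (Ac * (L : ℝ) ^ d * ∑ p ∈ Finset.Icc 1 s, ((admissible p D).card : ℝ) *
          ((2 / (1 - Real.exp (-(κ / 2 / (p : ℕ) / Real.sqrt d))) * Real.exp (κ / 2 / (p : ℕ) / Real.sqrt d)) ^ d) ^ (p - 1)) * momentConst D (2 * (k + 1)) K₀.toNNReal) ^ (k + 1))) +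
                      (Ac * (L : ℝ) ^ d * ∑ p ∈ Finset.Icc 1 s, ((admissible p D).card : ℝ) *
          ((2 / (1 - Real.exp (-(κ / 2 / (p : ℕ) / Real.sqrt d))) * Real.exp (κ / 2 / (p : ℕ) / Real.sqrt d)) ^ d) ^ (p - 1)) ^ (k + 1) * (2 ^ ((k + 1) * D) * 2 ^ 2 ^ ((k + 1) * D) *
                        ((((k + 1) * D : ℕ) : ℝ) * K₀ ^ ((k + 1) * D) * ε₃₁)))) / (k + 1)!)) := by
  have hA' : A.PosDef := posDef_of_coercive hAs hγA0 hγA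
  have hKpsd : IsPosSemidefKernel K := isPosSemidefKernel_kernel hK hA'
  have hdiagK : ∀ y, K y y ≤ (K₀.toNNReal : ℝ) := fun y =>
    ((le_abs_self _).trans (hKrR y y)).trans (Real.le_coe_toNNReal K₀)
  have hcJ : ∀ y ∈ J, K y y ≤ (K₀.toNNReal : ℝ) := fun y _ => hdiagK y
  have hL : 0 < L := by omega
  refine ⟨_, fun m =>
          (2 * (2 ^ ((t + 1).choose 2) * (4 * (s1Const s D d κ * Ac * b ^ D * (L : ℝ) ^ d)) ^ (t + 1) / (t + 1)!) +
                Real.exp (2 * (4 * (s1Const s D d κ * Ac * b ^ D * (L : ℝ) ^ d))) *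
                  (3 * (((shrink L m w).card : ℝ) * Real.exp (-(b ^ 2 / 4)))) +
                ∑ k ∈ Finset.range t,
                  (3 ^ (k + 1) * ((∑ π ∈ setPartitions (univ : Finset (Fin (k + 1))), ((π.card - 1)! : ℝ)) *
                      (s1Const s D d κ * Ac * b ^ D * Real.exp (-(κ / 4 * v)) * (L : ℝ) ^ d *
                        (4 * (s1Const s D d κ * Ac * b ^ D * (L : ℝ) ^ d)) ^ k)) +
                    3 ^ (k + 1) * (2 ^ (k + 1) * ((∑ π ∈ setPartitions (univ : Finset (Fin (k + 1))), ((π.card - 1)! : ℝ)) *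
                        ((min 1 (2 * ((shrink L m w).card : ℝ) * Real.exp (-(b ^ 2 / 4)))) ^ ((2 * (k + 1) : ℕ) : ℝ)⁻¹ *
                          ((1 + Ku) ^ D * (Ac * (L : ℝ) ^ d * ∑ p ∈ Finset.Icc 1 s, ((admissible p D).card : ℝ) *
          ((2 / (1 - Real.exp (-(κ / 2 / (p : ℕ) / Real.sqrt d))) * Real.exp (κ / 2 / (p : ℕ) / Real.sqrt d)) ^ d) ^ (p - 1)) * momentConst D (2 * (k + 1)) K₀.toNNReal) ^ (k + 1))) +
                      2 ^ ((k + 1) * D) * 2 ^ 2 ^ ((k + 1) * D) * K₀ ^ ((k + 1) * D) * Real.exp (-(δ / 2 * ((v : ℝ) + 1))) *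
                        (Ac * Real.exp (δ / 2 * ((D : ℝ) ^ 2 * d)) * (L : ℝ) ^ d * ∑ p ∈ Finset.Icc 1 s, ((admissible p D).card : ℝ) *
          ((2 / (1 - Real.exp (-((κ / 2 - δ / 2 * ((D : ℝ) ^ 2 * Real.sqrt d)) / (p : ℕ) / Real.sqrt d))) *
            Real.exp ((κ / 2 - δ / 2 * ((D : ℝ) ^ 2 * Real.sqrt d)) / (p : ℕ) / Real.sqrt d)) ^ d) ^ (p - 1)) ^ (k + 1)) +
                    3 ^ (k + 1) * (2 ^ (k + 1) * ((∑ π ∈ setPartitions (univ : Finset (Fin (k + 1))), ((π.card - 1)! : ℝ)) *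
                        ((min 1 (2 * ((shrink L m w).card : ℝ) * Real.exp (-(b ^ 2 / 4)))) ^ ((2 * (k + 1) : ℕ) : ℝ)⁻¹ *
                          ((1 + Ku) ^ D * (Ac * (L : ℝ) ^ d * ∑ p ∈ Finset.Icc 1 s, ((admissible p D).card : ℝ) *
          ((2 / (1 - Real.exp (-(κ / 2 / (p : ℕ) / Real.sqrt d))) * Real.exp (κ / 2 / (p : ℕ) / Real.sqrt d)) ^ d) ^ (p - 1)) * momentConst D (2 * (k + 1)) K₀.toNNReal) ^ (k + 1))) +
                      (Ac * (L : ℝ) ^ d * ∑ p ∈ Finset.Icc 1 s, ((admissible p D).card : ℝ) *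
          ((2 / (1 - Real.exp (-(κ / 2 / (p : ℕ) / Real.sqrt d))) * Real.exp (κ / 2 / (p : ℕ) / Real.sqrt d)) ^ d) ^ (p - 1)) ^ (k + 1) * (2 ^ ((k + 1) * D) * 2 ^ 2 ^ ((k + 1) * D) *
                        ((((k + 1) * D : ℕ) : ℝ) * K₀ ^ ((k + 1) * D) * ε₃₁)))) / (k + 1)!),
    hboxU_of_clusterRows hK hAs hγA0 hγA hL hΓΛ hBΛ hKb hκ hJ hJI hAc0 hA hv hb hγ1 hCΛ hCsh hKu hKuK hK₀1 hε₃₁ huI hKR hKrR hdec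
      huε hKε hvar hm (fun m _ => card_shrink_mul_exp_le hsmall)
      (fun m => ![fun p => tuplesIn J p (frame4 L w v m) ∪ crossT J p (frame4 L w v m) (frame3 L w v m),
        fun p => (tuplesIn J p (core L w m) \ tuplesIn J p (frame4 L w v m)) ∪
          (crossT J p (core L w m) (frame3 L w v m) \ crossT J p (frame4 L w v m) (frame3 L w v m)),
        fun p => crossT J p (frame1 L w m) (frame2 L w m) ∪ tuplesIn J p (frame2 L w m)])
      (fun m p => rfl) (fun m p => rfl) (fun m p => rfl)
      (fun m c => mass_classes_le (s := s) (D := D) (κ := κ) (J := J) (L := L) (w := w) (v := v) (m := m) hκ hAc0 hA hv c) hδ.le hδle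
      (fun m c => weightedMass_classes_le (s := s) (D := D) (κ := κ) (J := J) (L := L) (w := w) (v := v) (m := m) hAc0 hres hA hv c) t,
    ?_, fun m => rfl⟩
  have hid := Literature.MathematicalPhysics.QuantumFieldTheory.Balaban1983to89.B1Eq324BenfattoKernelSect5Identification.identification_upper
    (s := s) (D := D) (κ := κ) (L := L) (w := w) (v := v) (B := (J.image (boxIndex L))) hKpsd hcJ hJ
    (fun (c : Option (↥(J.image (boxIndex L)) × Bool)) (z : B1Eq324BenfattoLemma.Site d → ℝ) =>
        Option.elim c (hamiltonian s D κ a (corridors L w (J.image (boxIndex L))) z)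
          (fun mb => bif mb.2 then psi1pp s D κ a L w v (mb.1 : B1Eq324BenfattoLemma.Site d) z
            else psi1p s D κ a L w v (mb.1 : B1Eq324BenfattoLemma.Site d) z + psi2 s D κ a L w (mb.1 : B1Eq324BenfattoLemma.Site d) z))
    rfl (fun _ => rfl) (fun _ => rfl) t (fun m =>
          (2 * (2 ^ ((t + 1).choose 2) * (4 * (s1Const s D d κ * Ac * b ^ D * (L : ℝ) ^ d)) ^ (t + 1) / (t + 1)!) +
                Real.exp (2 * (4 * (s1Const s D d κ * Ac * b ^ D * (L : ℝ) ^ d))) *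
                  (3 * (((shrink L m w).card : ℝ) * Real.exp (-(b ^ 2 / 4)))) +
                ∑ k ∈ Finset.range t,
                  (3 ^ (k + 1) * ((∑ π ∈ setPartitions (univ : Finset (Fin (k + 1))), ((π.card - 1)! : ℝ)) *
                      (s1Const s D d κ * Ac * b ^ D * Real.exp (-(κ / 4 * v)) * (L : ℝ) ^ d *
                        (4 * (s1Const s D d κ * Ac * b ^ D * (L : ℝ) ^ d)) ^ k)) +
                    3 ^ (k + 1) * (2 ^ (k + 1) * ((∑ π ∈ setPartitions (univ : Finset (Fin (k + 1))), ((π.card - 1)! : ℝ)) *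
                        ((min 1 (2 * ((shrink L m w).card : ℝ) * Real.exp (-(b ^ 2 / 4)))) ^ ((2 * (k + 1) : ℕ) : ℝ)⁻¹ *
                          ((1 + Ku) ^ D * (Ac * (L : ℝ) ^ d * ∑ p ∈ Finset.Icc 1 s, ((admissible p D).card : ℝ) *
          ((2 / (1 - Real.exp (-(κ / 2 / (p : ℕ) / Real.sqrt d))) * Real.exp (κ / 2 / (p : ℕ) / Real.sqrt d)) ^ d) ^ (p - 1)) * momentConst D (2 * (k + 1)) K₀.toNNReal) ^ (k + 1))) +
                      2 ^ ((k + 1) * D) * 2 ^ 2 ^ ((k + 1) * D) * K₀ ^ ((k + 1) * D) * Real.exp (-(δ / 2 * ((v : ℝ) + 1))) *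
                        (Ac * Real.exp (δ / 2 * ((D : ℝ) ^ 2 * d)) * (L : ℝ) ^ d * ∑ p ∈ Finset.Icc 1 s, ((admissible p D).card : ℝ) *
          ((2 / (1 - Real.exp (-((κ / 2 - δ / 2 * ((D : ℝ) ^ 2 * Real.sqrt d)) / (p : ℕ) / Real.sqrt d))) *
            Real.exp ((κ / 2 - δ / 2 * ((D : ℝ) ^ 2 * Real.sqrt d)) / (p : ℕ) / Real.sqrt d)) ^ d) ^ (p - 1)) ^ (k + 1)) +
                    3 ^ (k + 1) * (2 ^ (k + 1) * ((∑ π ∈ setPartitions (univ : Finset (Fin (k + 1))), ((π.card - 1)! : ℝ)) *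
                        ((min 1 (2 * ((shrink L m w).card : ℝ) * Real.exp (-(b ^ 2 / 4)))) ^ ((2 * (k + 1) : ℕ) : ℝ)⁻¹ *
                          ((1 + Ku) ^ D * (Ac * (L : ℝ) ^ d * ∑ p ∈ Finset.Icc 1 s, ((admissible p D).card : ℝ) *
          ((2 / (1 - Real.exp (-(κ / 2 / (p : ℕ) / Real.sqrt d))) * Real.exp (κ / 2 / (p : ℕ) / Real.sqrt d)) ^ d) ^ (p - 1)) * momentConst D (2 * (k + 1)) K₀.toNNReal) ^ (k + 1))) +
                      (Ac * (L : ℝ) ^ d * ∑ p ∈ Finset.Icc 1 s, ((admissible p D).card : ℝ) *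
          ((2 / (1 - Real.exp (-(κ / 2 / (p : ℕ) / Real.sqrt d))) * Real.exp (κ / 2 / (p : ℕ) / Real.sqrt d)) ^ d) ^ (p - 1)) ^ (k + 1) * (2 ^ ((k + 1) * D) * 2 ^ 2 ^ ((k + 1) * D) *
                        ((((k + 1) * D : ℕ) : ℝ) * K₀ ^ ((k + 1) * D) * ε₃₁)))) / (k + 1)!))
  have hcs := cumulantSide_le (s := s) (D := D) (κ := κ) (J := J) (L := L) (w := w) (v := v) hKpsd hdiagK hK₀1 hKdec hJ hAc0 hA hL
    hL2 hv hδ hδle hres t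
  refine (le_of_eq (Finset.sum_congr rfl fun m _ => rfl)).trans (hid.trans ?_)
  linarith

end Step

end Literature.MathematicalPhysics.QuantumFieldTheory.Balaban1983to89.B1Eq324BenfattoKernelSect5StepBoundUpper

end
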